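import Summits.BirchSwinnertonDyer.BirchSwinnertonDyer.Theorems.ShaPrimaryTransferFiniteShaComponentTransferOddDoor
import Literature.NumberTheory.EllipticCurves.ShaIsogenyTorsionBound
import HarnessLib

/-!
# BirchSwinnertonDyer / ShaPrimaryTransfer — crux `FiniteShaComponentTransfer` (stmt-BirchSwinnertonDyer-22356):
# THE ODD DOOR READ ON A `p`-ISOGENY DESCENT (degree-free form; any number field)

Fifth helper file of prover seat `bsd-line-spt-p1` g13 (`--supports stmt-22356 --as helper`; namespace `…ShaPrimaryTransferOddDoor`).
THEOREMS ONLY; no definition, no named fact, no `sorry`. BSD is NOT proved by any of this; T is unchanged.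

A descent via a `p`-isogeny `φ : E → E'` with dual `ψ` (`ψ ∘ φ = [p]`, `p` prime; the tree's `3`-isogeny `CPMuDescent`, `5`-isogeny
`KubertTate`, `2`-isogeny `TwoIsogeny*` instruments) computes `L = #ker Ш(φ) = #Ш(E)[φ]` and `L' = #ker Ш(ψ) = #Ш(E')[ψ]`. The tree
now has the bracket `L ≤ #Ш(E/K)[p] ≤ L · L'` (`ShaIsogenyTorsionBound`) and `#Ш(E/K)[p] = p^{t_p(E) + 2m}` (`…OddDoor` §1). Hence:

* §1 `one_le_shaCorank_of_ker_dual_eq_bot_of_odd` — **sharp dual side (`ker Ш(ψ) = ⊥`) with `L = p^d`, `d` ODD ⟹ `t_p(E) ≥ 1`**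
  (`Ш(E/K)[p^∞]` infinite: `infinite_shaPrimary_of_ker_dual_eq_bot_of_odd`); `even_of_shaCorank_eq_zero_of_ker_dual_eq_bot` —
  closed door + sharp dual ⟹ `d` even.
* §2 `natCard_sha_torsionBy_eq_of_sq` — **closed door (`t_p(E) = 0`), `L = p^{2a}`, WEAK dual bound `L' < p²` ⟹ `#Ш(E/K)[p] = L`**
  (the only even power of `p` in `[p^{2a}, p^{2a} L']`).
* §3 `le_natCard_ker_dual_of_shaCorank_eq_zero_of_odd` — **closed door and `L = p^d` with `d` odd ⟹ `L' ≥ p`**: parity forces a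
  non-trivial `ψ`-defect on the isogenous curve; `natCard_sha_torsionBy_eq_pow_succ_of_odd` — and `#Ш(E/K)[p] = p^{d+1}` if `L' < p²`.

The `2`-isogeny file `…OddDoorIsogenyDescent` is the same in the `Ξ`-currency of `TwoIsogenySelmerGroupSha`.

References: [MilneADT2006] Ch. I Lemma 7.1(b) (proof); [SilvermanAEC2009] Thm. X.4.2(a), X.4.14; [Cassels1962ArithmeticIV] Thm. 1.1;
[Dokchitser2013ParityNotes] §2.
-/

-- D-0017: single-problem summit, so `Summit.BirchSwinnertonDyer.BirchSwinnertonDyer.…` repeats a namespace BY DESIGN.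
set_option linter.dupNamespace false
set_option autoImplicit false

noncomputable section

open scoped Classical
open scoped AddSubgroup
open Literature.NumberTheory.EllipticCurves WeierstrassCurve WeierstrassCurve.Isogeny

namespace Summit.BirchSwinnertonDyer.BirchSwinnertonDyer.Theorems.ShaPrimaryTransferOddDoor

variable {K : Type} [Field K] [NumberField K] {W W' : WeierstrassCurve K} [W.IsElliptic]
  (φ : Isogeny W W') (ψ : Isogeny W' W) (p : ℕ) [hp : Fact p.Prime]

/-- Powers of a prime in an interval `[p^a, p^a · L']` with `L' < p²`: the only exponent of the parity of `a` is `a`. [folklore] -/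
theorem pow_eq_of_le_of_le_mul {a e L' : ℕ} (h1 : p ^ a ≤ p ^ e) (h2 : p ^ e ≤ p ^ a * L') (hL' : L' < p ^ 2)
    (hpar : e % 2 = a % 2) : e = a := by
  have hp1 : 1 < p := hp.out.one_lt
  have hae : a ≤ e := (Nat.pow_le_pow_iff_right hp1).mp h1
  have hlt : p ^ e < p ^ (a + 2) := by
    calc p ^ e ≤ p ^ a * L' := h2
      _ < p ^ a * p ^ 2 := mul_lt_mul_of_pos_left hL' (by positivity)
      _ = p ^ (a + 2) := by rw [← pow_add]
  have hea : e < a + 2 := (Nat.pow_lt_pow_iff_right hp1).mp hlt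
  omega

/-! ## §1 Sharp dual side: `#Ш[p] = #ker Ш(φ)`, so an odd exponent certifies `t_p ≥ 1` -/

/-- **Sharp dual `p`-isogeny descent with an ODD defect exponent certifies infinite `Ш`**: `ψ ∘ φ = [p]`, `ker Ш(ψ) = ⊥`,
`#ker Ш(φ) = p^d` with `d` odd ⟹ `t_p(E) ≥ 1`. [cite: MilneADT2006, Ch. I Lemma 7.1(b) (proof), p. 96] [cite: Dokchitser2013ParityNotes, §2] -/
theorem one_le_shaCorank_of_ker_dual_eq_bot_of_odd (h : ∀ P, ψ (φ P) = (p : ℤ) • P)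
    (hψ : (shaMap ψ.toAddMonoidHom ψ.equivariant ψ.hasLocalPointsMaps_toAddMonoidHom).ker = ⊥) {d : ℕ}
    (hL : Nat.card (shaMap φ.toAddMonoidHom φ.equivariant φ.hasLocalPointsMaps_toAddMonoidHom).ker = p ^ d) (hodd : Odd d) :
    1 ≤ W.shaCorank p := by
  haveI : Finite (shaMap φ.toAddMonoidHom φ.equivariant φ.hasLocalPointsMaps_toAddMonoidHom).ker :=
    Nat.finite_of_card_ne_zero (by rw [hL]; exact pow_ne_zero _ hp.out.ne_zero)
  have hN : Nat.card (W.sha[(p : ℤ)]) = p ^ d := by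
    rw [natCard_sha_torsionBy_eq_of_ker_shaMap_eq_bot φ ψ hp.out.ne_zero h hψ, hL]
  refine one_le_shaCorank_of_not_isSquare W p ?_
  rw [hN, isSquare_prime_pow_iff p]
  exact Nat.not_even_iff_odd.mpr hodd

/-- … hence `Ш(E/K)[p^∞]` is infinite. [cite: Dokchitser2013ParityNotes, §2] -/
theorem infinite_shaPrimary_of_ker_dual_eq_bot_of_odd (h : ∀ P, ψ (φ P) = (p : ℤ) • P)
    (hψ : (shaMap ψ.toAddMonoidHom ψ.equivariant ψ.hasLocalPointsMaps_toAddMonoidHom).ker = ⊥) {d : ℕ}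
    (hL : Nat.card (shaMap φ.toAddMonoidHom φ.equivariant φ.hasLocalPointsMaps_toAddMonoidHom).ker = p ^ d) (hodd : Odd d) :
    Infinite ↥(AddCommGroup.primaryComponent W.sha p) := by
  have h1 := one_le_shaCorank_of_ker_dual_eq_bot_of_odd φ ψ p h hψ hL hodd
  rw [← not_finite_iff_infinite, finite_primaryComponent_sha_iff_shaCorank_eq_zero W p]
  omega

/-- **Closed door + sharp dual ⟹ even defect exponent**: `t_p(E) = 0`, `ker Ш(ψ) = ⊥`, `#ker Ш(φ) = p^d ⟹ d` even.
[cite: Dokchitser2013ParityNotes, §2] -/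
theorem even_of_shaCorank_eq_zero_of_ker_dual_eq_bot (h0 : W.shaCorank p = 0) (h : ∀ P, ψ (φ P) = (p : ℤ) • P)
    (hψ : (shaMap ψ.toAddMonoidHom ψ.equivariant ψ.hasLocalPointsMaps_toAddMonoidHom).ker = ⊥) {d : ℕ}
    (hL : Nat.card (shaMap φ.toAddMonoidHom φ.equivariant φ.hasLocalPointsMaps_toAddMonoidHom).ker = p ^ d) : Even d := by
  by_contra hd
  have h1 := one_le_shaCorank_of_ker_dual_eq_bot_of_odd φ ψ p h hψ hL (Nat.not_even_iff_odd.mp hd)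
  omega

/-! ## §2 Closed door, square defect, weak dual bound -/

/-- **`#Ш(E/K)[p] = #ker Ш(φ)` from a closed door, a square defect and a WEAK dual bound**: `t_p(E) = 0`,
`#ker Ш(φ) = p^{2a}`, `#ker Ш(ψ) < p²` ⟹ `#Ш(E/K)[p] = p^{2a}`. [cite: MilneADT2006, Ch. I Lemma 7.1(b) (proof), p. 96]
[cite: Dokchitser2013ParityNotes, §2] -/
theorem natCard_sha_torsionBy_eq_of_sq (h0 : W.shaCorank p = 0) (h : ∀ P, ψ (φ P) = (p : ℤ) • P) {a : ℕ}
    (hL : Nat.card (shaMap φ.toAddMonoidHom φ.equivariant φ.hasLocalPointsMaps_toAddMonoidHom).ker = p ^ (2 * a))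
    [Finite (shaMap ψ.toAddMonoidHom ψ.equivariant ψ.hasLocalPointsMaps_toAddMonoidHom).ker]
    (hL' : Nat.card (shaMap ψ.toAddMonoidHom ψ.equivariant ψ.hasLocalPointsMaps_toAddMonoidHom).ker < p ^ 2) :
    Nat.card (W.sha[(p : ℤ)]) = p ^ (2 * a) := by
  haveI : Finite (shaMap φ.toAddMonoidHom φ.equivariant φ.hasLocalPointsMaps_toAddMonoidHom).ker :=
    Nat.finite_of_card_ne_zero (by rw [hL]; exact pow_ne_zero _ hp.out.ne_zero)
  have hup := natCard_sha_torsionBy_le_mul_natCard_ker_shaMap φ ψ h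
  have hlow := natCard_ker_shaMap_le_natCard_sha_torsionBy φ ψ hp.out.ne_zero h
  obtain ⟨m, hm⟩ := exists_natCard_sha_torsionBy_eq_pow W p
  rw [h0, zero_add] at hm
  rw [hm] at hup hlow ⊢
  rw [hL] at hup hlow
  rw [pow_eq_of_le_of_le_mul p hlow hup hL' (by omega)]

/-! ## §3 Closed door and odd defect exponent: the dual side cannot be sharp -/

/-- **Parity propagates across the `p`-isogeny**: `t_p(E) = 0` and `#ker Ш(φ) = p^d` with `d` ODD ⟹ `#ker Ш(ψ) ≥ p`.
[cite: MilneADT2006, Ch. I Lemma 7.1(b) (proof), p. 96] [cite: Dokchitser2013ParityNotes, §2] -/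
theorem le_natCard_ker_dual_of_shaCorank_eq_zero_of_odd (h0 : W.shaCorank p = 0) (h : ∀ P, ψ (φ P) = (p : ℤ) • P)
    {d : ℕ} (hL : Nat.card (shaMap φ.toAddMonoidHom φ.equivariant φ.hasLocalPointsMaps_toAddMonoidHom).ker = p ^ d)
    (hodd : Odd d) [Finite (shaMap ψ.toAddMonoidHom ψ.equivariant ψ.hasLocalPointsMaps_toAddMonoidHom).ker] :
    p ≤ Nat.card (shaMap ψ.toAddMonoidHom ψ.equivariant ψ.hasLocalPointsMaps_toAddMonoidHom).ker := by
  haveI : Finite (shaMap φ.toAddMonoidHom φ.equivariant φ.hasLocalPointsMaps_toAddMonoidHom).ker :=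
    Nat.finite_of_card_ne_zero (by rw [hL]; exact pow_ne_zero _ hp.out.ne_zero)
  have hp1 : 1 < p := hp.out.one_lt
  have hup := natCard_sha_torsionBy_le_mul_natCard_ker_shaMap φ ψ h
  have hlow := natCard_ker_shaMap_le_natCard_sha_torsionBy φ ψ hp.out.ne_zero h
  obtain ⟨m, hm⟩ := exists_natCard_sha_torsionBy_eq_pow W p
  rw [h0, zero_add] at hm
  rw [hm] at hup hlow
  rw [hL] at hup hlow
  -- `d ≤ 2m` and `d` odd give `d + 1 ≤ 2m`, so `p^d · p ≤ p^(2m) ≤ p^d · L'`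
  have hle : d ≤ 2 * m := (Nat.pow_le_pow_iff_right hp1).mp hlow
  obtain ⟨k, rfl⟩ := hodd
  have hle' : 2 * k + 1 + 1 ≤ 2 * m := by omega
  have h2 : p ^ (2 * k + 1) * p ≤ p ^ (2 * m) := by
    rw [← pow_succ]; exact Nat.pow_le_pow_right hp.out.pos hle'
  have hpos : 0 < p ^ (2 * k + 1) := by positivity
  exact Nat.le_of_mul_le_mul_left (h2.trans hup) hpos

/-- **… and `#Ш(E/K)[p] = p^{d+1}` if the dual defect is `< p²`.** [cite: Dokchitser2013ParityNotes, §2] -/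
theorem natCard_sha_torsionBy_eq_pow_succ_of_odd (h0 : W.shaCorank p = 0) (h : ∀ P, ψ (φ P) = (p : ℤ) • P)
    {d : ℕ} (hL : Nat.card (shaMap φ.toAddMonoidHom φ.equivariant φ.hasLocalPointsMaps_toAddMonoidHom).ker = p ^ d)
    (hodd : Odd d) [Finite (shaMap ψ.toAddMonoidHom ψ.equivariant ψ.hasLocalPointsMaps_toAddMonoidHom).ker]
    (hL' : Nat.card (shaMap ψ.toAddMonoidHom ψ.equivariant ψ.hasLocalPointsMaps_toAddMonoidHom).ker < p ^ 2) :
    Nat.card (W.sha[(p : ℤ)]) = p ^ (d + 1) := by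
  haveI : Finite (shaMap φ.toAddMonoidHom φ.equivariant φ.hasLocalPointsMaps_toAddMonoidHom).ker :=
    Nat.finite_of_card_ne_zero (by rw [hL]; exact pow_ne_zero _ hp.out.ne_zero)
  have hp1 : 1 < p := hp.out.one_lt
  have hup := natCard_sha_torsionBy_le_mul_natCard_ker_shaMap φ ψ h
  have hlow := natCard_ker_shaMap_le_natCard_sha_torsionBy φ ψ hp.out.ne_zero h
  obtain ⟨m, hm⟩ := exists_natCard_sha_torsionBy_eq_pow W p
  rw [h0, zero_add] at hm
  rw [hm] at hup hlow ⊢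
  rw [hL] at hup hlow
  obtain ⟨k, rfl⟩ := hodd
  have hle : 2 * k + 1 ≤ 2 * m := (Nat.pow_le_pow_iff_right hp1).mp hlow
  have hlt : p ^ (2 * m) < p ^ (2 * k + 3) := by
    calc p ^ (2 * m) ≤ p ^ (2 * k + 1) * Nat.card (shaMap ψ.toAddMonoidHom ψ.equivariant ψ.hasLocalPointsMaps_toAddMonoidHom).ker := hup
      _ < p ^ (2 * k + 1) * p ^ 2 := mul_lt_mul_of_pos_left hL' (by positivity)
      _ = p ^ (2 * k + 3) := by rw [← pow_add]
  have hlt' : 2 * m < 2 * k + 3 := (Nat.pow_lt_pow_iff_right hp1).mp hlt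
  have : 2 * m = 2 * k + 1 + 1 := by omega
  rw [this]

end Summit.BirchSwinnertonDyer.BirchSwinnertonDyer.Theorems.ShaPrimaryTransferOddDoor

end
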